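import Literature.Claims.NS.Siche2026
import Literature.Analysis.FunctionSpaces.TorusFourierModes
import Literature.Analysis.FunctionSpaces.TorusClassicalNSGluing
import Literature.Analysis.FunctionSpaces.TorusSpaceTime
import Literature.Analysis.FunctionSpaces.TorusCalculusProofs
import Literature.Analysis.FluidPDE.TorusClassicalLerayHopfProofs
import HarnessLib

/-!
# Streamwise-constant Fourier modes decaying by the heat law are exact global Navier–Stokes /
# Leray–Hopf solutions on `𝕋³` (analytic core of the C135 `Siche2026` countermodels)

For a finite frequency set `S ⊂ ℤ³` of wavevectors ALONG the first axis (`k 1 = k 2 = 0`) and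
coefficients `c k ∈ ℂ³` with no first component (`c k 0 = 0`), the field
`U(t, x) = Re ∑_{k∈S} e^{-4π²ν|k|²t} e^{2πi k·x} c k` (a parallel shear flow depending on `x 0` only)
has `(U·∇)U = 0`, `div U = 0`, `ΔU` diagonal, hence solves Navier–Stokes with zero force and zero
pressure on `ℝ × 𝕋³` classically, and is a global Leray–Hopf solution from `U(0) = realTrigPoly S c`.
-/

set_option linter.dupNamespace false

noncomputable section

open Set Function MeasureTheory UnitAddTorus
open scoped ContDiff RealInnerProductSpace InnerProductSpace ComplexConjugate

namespace Summit.NavierStokesRegularity.NavierStokesRegularity.Theorems.Siche2026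

open Literature.Analysis.FunctionSpaces Literature.Analysis.FunctionSpaces.Torus
open Literature.Claims.NS.Siche2026 (T3 E3 Z3 C3)

/-- heat decay rate of the mode `k`: `λ_k = 4π²ν|k|²`. -/
def rate (ν : ℝ) (k : Z3) : ℝ := 4 * Real.pi ^ 2 * ν * freqNormSq k

/-- the decayed coefficients `e^{-λ_k t} c k`. -/
def heatCoeff (ν : ℝ) (c : Z3 → C3) (t : ℝ) (k : Z3) : C3 :=
  ((Real.exp (-(rate ν k * t)) : ℝ) : ℂ) • c k

/-- the heat flow of the real trigonometric polynomial `realTrigPoly S c`. -/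
def heatFlow (ν : ℝ) (S : Finset Z3) (c : Z3 → C3) (t : ℝ) : T3 → E3 :=
  realTrigPoly S (heatCoeff ν c t)

/-- a single real mode `x ↦ Re (e_k(x) • v)`. -/
def mode (k : Z3) (v : C3) (x : T3) : E3 := EuclideanSpace.realPart (mFourier k x • v)

/-- `Re (r • v) = r • Re v` for real `r`. [folklore] -/
theorem realPart_ofReal_smul (r : ℝ) (v : C3) :
    EuclideanSpace.realPart ((r : ℂ) • v) = r • EuclideanSpace.realPart v := by
  ext i
  simp [EuclideanSpace.realPart_apply]

/-- at `t = 0` the decayed coefficients are the coefficients. [folklore] -/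
theorem heatCoeff_zero (ν : ℝ) (c : Z3 → C3) : heatCoeff ν c 0 = c := by
  funext k; simp [heatCoeff]

/-- the heat flow starts at `realTrigPoly S c`. [folklore] -/
theorem heatFlow_zero (ν : ℝ) (S : Finset Z3) (c : Z3 → C3) : heatFlow ν S c 0 = realTrigPoly S c := by
  rw [heatFlow, heatCoeff_zero]

/-- `U(t, x) = ∑_{k∈S} e^{-λ_k t} • Re (e_k(x) • c k)`. -/
theorem heatFlow_apply_eq_sum (ν : ℝ) (S : Finset Z3) (c : Z3 → C3) (t : ℝ) (x : T3) :
    heatFlow ν S c t x = ∑ k ∈ S, Real.exp (-(rate ν k * t)) • mode k (c k) x := by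
  rw [heatFlow, realTrigPoly_apply_eq_sum]
  refine Finset.sum_congr rfl fun k _ => ?_
  rw [heatCoeff, smul_comm, realPart_ofReal_smul, mode]

/-- the heat flow as a function of `(t, x)`: a finite sum of decaying modes. [folklore] -/
theorem heatFlow_eq (ν : ℝ) (S : Finset Z3) (c : Z3 → C3) :
    heatFlow ν S c = fun t x => ∑ k ∈ S, Real.exp (-(rate ν k * t)) • mode k (c k) x := by
  funext t x; exact heatFlow_apply_eq_sum ν S c t x

/-- a single real mode is smooth on the torus. [folklore] -/
theorem isSmooth_mode (k : Z3) (v : C3) : IsSmooth (mode k v) := by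
  have h := IsSmooth.comp_clm EuclideanSpace.realPart (isSmooth_mFourier_smul k v)
  exact h

/-- The heat flow is jointly smooth on `ℝ × 𝕋³`. -/
theorem isSmoothSpaceTimeOn_heatFlow (ν : ℝ) (S : Finset Z3) (c : Z3 → C3) (T : Set ℝ) :
    IsSmoothSpaceTimeOn T (heatFlow ν S c) := by
  rw [heatFlow_eq]
  refine IsSmoothSpaceTimeOn.sum fun k _ => ?_
  refine IsSmoothSpaceTimeOn.smul ?_ (isSmoothSpaceTimeOn_const (isSmooth_mode k (c k)) T)
  refine isSmoothSpaceTimeOn_of_contDiff ?_ T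
  have : stLift (fun (t : ℝ) (_ : T3) => Real.exp (-(rate ν k * t))) =
      fun z : ℝ × EuclideanSpace ℝ (Fin 3) => Real.exp (-(rate ν k * z.1)) := by
    funext z; rfl
  rw [this]
  fun_prop

/-- `∂ₜ U(t, x) = -∑ λ_k e^{-λ_k t} Re(e_k c_k) = realTrigPoly S (k ↦ -λ_k • heatCoeff t k)`. -/
theorem timeDerivWithin_heatFlow (ν : ℝ) (S : Finset Z3) (c : Z3 → C3) (t : ℝ) (x : T3) :
    Torus.timeDerivWithin univ (heatFlow ν S c) t x =
      realTrigPoly S (fun k => -(((rate ν k : ℝ) : ℂ) • heatCoeff ν c t k)) x := by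
  rw [Torus.timeDerivWithin, derivWithin_univ]
  have hfun : (fun τ => heatFlow ν S c τ x) = fun τ => ∑ k ∈ S, Real.exp (-(rate ν k * τ)) • mode k (c k) x := by
    funext τ; exact heatFlow_apply_eq_sum ν S c τ x
  rw [hfun]
  have hd : HasDerivAt (fun τ => ∑ k ∈ S, Real.exp (-(rate ν k * τ)) • mode k (c k) x)
      (∑ k ∈ S, (-(rate ν k) * Real.exp (-(rate ν k * t))) • mode k (c k) x) t := by
    refine HasDerivAt.fun_sum (u := S) (A := fun k τ => Real.exp (-(rate ν k * τ)) • mode k (c k) x)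
      (A' := fun k => (-(rate ν k) * Real.exp (-(rate ν k * t))) • mode k (c k) x) fun k _ => ?_
    have h1 : HasDerivAt (fun τ => -(rate ν k * τ)) (-(rate ν k)) t := by
      have h0 : HasDerivAt (fun τ => rate ν k * τ) (rate ν k) t := by
        simpa using (hasDerivAt_id t).const_mul (rate ν k)
      exact h0.fun_neg
    have h2 : HasDerivAt (fun τ => Real.exp (-(rate ν k * τ))) (Real.exp (-(rate ν k * t)) * (-(rate ν k))) t :=
      h1.exp
    have h3 := h2.smul_const (mode k (c k) x)
    simpa [mul_comm] using h3
  rw [hd.deriv, realTrigPoly_apply_eq_sum]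
  refine Finset.sum_congr rfl fun k _ => ?_
  have hco : -(((rate ν k : ℝ) : ℂ) • heatCoeff ν c t k) =
      (((-(rate ν k) * Real.exp (-(rate ν k * t)) : ℝ)) : ℂ) • c k := by
    rw [heatCoeff, smul_smul, ← neg_smul, ← Complex.ofReal_mul, ← Complex.ofReal_neg, neg_mul]
  rw [hco, smul_comm, realPart_ofReal_smul, mode]

/-- `ν • realTrigPoly S c' = realTrigPoly S (ν • c')`. -/
theorem smul_realTrigPoly (a : ℝ) (S : Finset Z3) (c' : Z3 → C3) (x : T3) :
    a • realTrigPoly S c' x = realTrigPoly S (fun k => ((a : ℝ) : ℂ) • c' k) x := by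
  rw [realTrigPoly_apply_eq_sum, realTrigPoly_apply_eq_sum, Finset.smul_sum]
  refine Finset.sum_congr rfl fun k _ => ?_
  rw [smul_comm (mFourier k x), realPart_ofReal_smul]

section Cross

variable {S : Finset Z3} {c : Z3 → C3}

/-! CROSS-TRANSVERSALITY (a hypothesis written inline, `∀ k ∈ S, ∀ l ∈ S, ∑ j, l j * c k j = 0`): every
coefficient vector is orthogonal to EVERY wavevector of `S` — parallel shear flows (all `l ∥ e₀`, `c k ⊥ e₀`),
2.5-D columnar flows (all `l ⊥ e₂`, `c k ∥ e₂`), … . The diagonal `k = l` is transversality (incompressibility). -/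

/-- cross-transversality contains transversality (the diagonal `k = l`). [folklore] -/
theorem isTransversal_of_cross (h : ∀ k ∈ S, ∀ l ∈ S, ∑ j, (l j : ℂ) * c k j = 0) : IsTransversal S c :=
  fun k hk => h k hk k hk

/-- cross-transversality is stable under scalar rescaling of the coefficients. [folklore] -/
theorem cross_smul (h : ∀ k ∈ S, ∀ l ∈ S, ∑ j, (l j : ℂ) * c k j = 0) (a : Z3 → ℂ) :
    ∀ k ∈ S, ∀ l ∈ S, ∑ j, (l j : ℂ) * (fun k => a k • c k) k j = 0 := by
  intro k hk l hl
  have h0 := h k hk l hl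
  simp only [PiLp.smul_apply, smul_eq_mul]
  calc ∑ j, (l j : ℂ) * (a k * c k j) = a k * ∑ j, (l j : ℂ) * c k j := by
        rw [Finset.mul_sum]; exact Finset.sum_congr rfl fun j _ => by ring
    _ = 0 := by rw [h0, mul_zero]

/-- the decayed coefficients stay cross-transversal. [folklore] -/
theorem cross_heatCoeff (h : ∀ k ∈ S, ∀ l ∈ S, ∑ j, (l j : ℂ) * c k j = 0) (ν t : ℝ) :
    ∀ k ∈ S, ∀ l ∈ S, ∑ j, (l j : ℂ) * heatCoeff ν c t k j = 0 :=
  cross_smul h _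

/-- coordinates of a real trigonometric polynomial -/
theorem realTrigPoly_apply_coord_eq_sum (c' : Z3 → C3) (x : T3) (j : Fin 3) :
    realTrigPoly S c' x j = ∑ k ∈ S, (mFourier k x * c' k j).re := by
  rw [realTrigPoly_apply_coord, trigPoly_apply, ← Complex.re_sum]
  congr 1
  simp [Finset.sum_apply]

/-- The velocity is pointwise orthogonal to every wavevector: `U(x) · l = 0` for `l ∈ S`. -/
theorem sum_realTrigPoly_apply_mul_eq_zero (h : ∀ k ∈ S, ∀ l ∈ S, ∑ j, (l j : ℂ) * c k j = 0) (x : T3) {l : Z3} (hl : l ∈ S) :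
    ∑ j, realTrigPoly S c x j * (l j : ℝ) = 0 := by
  simp_rw [realTrigPoly_apply_coord_eq_sum, Finset.sum_mul]
  rw [Finset.sum_comm]
  refine Finset.sum_eq_zero fun k hk => ?_
  have h1 : ∀ j, (mFourier k x * c k j).re * (l j : ℝ) = (mFourier k x * ((l j : ℂ) * c k j)).re := by
    intro j
    have : mFourier k x * ((l j : ℂ) * c k j) = (mFourier k x * c k j) * ((l j : ℝ) : ℂ) := by
      push_cast; ring
    rw [this, Complex.re_mul_ofReal]
  simp_rw [h1]
  rw [← Complex.re_sum, ← Finset.mul_sum, h k hk l hl, mul_zero, Complex.zero_re]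

/-- **The self-advection of a cross-transversal flow vanishes**: `(U·∇)U = 0`. -/
theorem convect_realTrigPoly_self (h : ∀ k ∈ S, ∀ l ∈ S, ∑ j, (l j : ℂ) * c k j = 0) (x : T3) :
    Torus.convect (realTrigPoly S c) (realTrigPoly S c) x = 0 := by
  unfold Torus.convect
  rw [fderiv_apply_eq_sum_partialDeriv ((isSmooth_realTrigPoly S c).isContDiff (by simp)) x]
  simp_rw [partialDeriv_realTrigPoly, smul_realTrigPoly]
  rw [sum_realTrigPoly]
  have h0 : realTrigPoly S (fun l => ∑ j : Fin 3, ((realTrigPoly S c x j : ℝ) : ℂ) •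
      ((2 * Real.pi * Complex.I * (l j)) • c l)) = realTrigPoly S 0 := by
    refine realTrigPoly_congr fun l hl => ?_
    simp_rw [smul_smul, ← Finset.sum_smul]
    have : ∑ j : Fin 3, ((realTrigPoly S c x j : ℝ) : ℂ) * (2 * Real.pi * Complex.I * (l j)) =
        2 * Real.pi * Complex.I * (((∑ j, realTrigPoly S c x j * (l j : ℝ)) : ℝ) : ℂ) := by
      push_cast
      rw [Finset.mul_sum]
      exact Finset.sum_congr rfl fun j _ => by ring
    rw [this, sum_realTrigPoly_apply_mul_eq_zero h x hl]
    simp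
  rw [h0, realTrigPoly_zero]
  rfl

/-- the zero pressure has zero gradient. [folklore] -/
theorem gradient_zero_fun (x : T3) : Torus.gradient (fun _ : T3 => (0 : ℝ)) x = 0 := by
  unfold Torus.gradient Torus.liftAt
  simp [_root_.gradient]

/-- **The heat flow of cross-transversal modes is a classical Navier–Stokes solution on `ℝ × 𝕋³`
with zero force and zero pressure.** -/
theorem isClassicalNSSolutionOn_heatFlow (ν : ℝ) (h : ∀ k ∈ S, ∀ l ∈ S, ∑ j, (l j : ℂ) * c k j = 0) :
    Torus.IsClassicalNSSolutionOn univ ν (fun _ _ => (0 : E3)) (heatFlow ν S c) (fun _ _ => (0 : ℝ)) where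
  smooth_velocity := isSmoothSpaceTimeOn_heatFlow ν S c univ
  smooth_pressure := isSmoothSpaceTimeOn_const (isSmooth_const (0 : ℝ)) univ
  momentum := by
    intro t _ x
    rw [timeDerivWithin_heatFlow, heatFlow, convect_realTrigPoly_self (cross_heatCoeff h ν t) x,
      laplacian_realTrigPoly, gradient_zero_fun, smul_realTrigPoly, add_zero, sub_zero, add_zero]
    refine congrFun (realTrigPoly_congr fun k _ => ?_) x
    rw [smul_neg, smul_smul, ← Complex.ofReal_mul, rate]
    congr 2
    push_cast
    ring
  divFree := fun t _ =>
    isDivFree_realTrigPoly (isTransversal_of_cross (cross_heatCoeff h ν t))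

/-- **The heat flow of cross-transversal modes is a global Leray–Hopf solution from `realTrigPoly S c`.** -/
theorem isGlobalLerayHopf_heatFlow (ν : ℝ) (h : ∀ k ∈ S, ∀ l ∈ S, ∑ j, (l j : ℂ) * c k j = 0) :
    Literature.Analysis.FluidPDE.Torus.IsGlobalLerayHopf ν (fun _ _ => (0 : E3)) (realTrigPoly S c) (heatFlow ν S c) := by
  have h' := (isClassicalNSSolutionOn_heatFlow ν h).isGlobalLerayHopf
  rwa [heatFlow_zero] at h'

/-! ### The two stock geometries -/

/-- parallel shear: wavevectors along `e₀`, coefficients without `e₀` component -/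
theorem crossTransversal_of_streamwise (hS : ∀ k ∈ S, k 1 = 0 ∧ k 2 = 0) (hc : ∀ k ∈ S, c k 0 = 0) :
    ∀ k ∈ S, ∀ l ∈ S, ∑ j, (l j : ℂ) * c k j = 0 := by
  intro k hk l hl
  obtain ⟨h1, h2⟩ := hS l hl
  simp [Fin.sum_univ_three, h1, h2, hc k hk]

/-- columnar (2.5-D) flows: horizontal wavevectors, vertical coefficients -/
theorem crossTransversal_of_columnar (hS : ∀ k ∈ S, k 2 = 0) (hc : ∀ k ∈ S, c k 0 = 0 ∧ c k 1 = 0) :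
    ∀ k ∈ S, ∀ l ∈ S, ∑ j, (l j : ℂ) * c k j = 0 := by
  intro k hk l hl
  obtain ⟨h0, h1⟩ := hc k hk
  simp [Fin.sum_univ_three, h0, h1, hS l hl]

end Cross

end Summit.NavierStokesRegularity.NavierStokesRegularity.Theorems.Siche2026
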